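import Summits.HodgeConjecture.CorCM.Census.DodecicC6C2Lattice

/-!
# Dodecic atlas, type `ℤ/6 × ℤ/2` (sequel 2): minimality `μ = 5` by an `𝔽₄`-invariant — no four Galois orbits generate

COR-CM (cell `pub-hodgecm2`), count-neutral kernel census by the binder seat b17 (gen 39; claim C62-KERNEL).  Sequel of
`Census/DodecicC6C2Species.lean` and `…Lattice.lean` (`lattice_theorem : hodgeLattice = pairs ⊔ markman ⊔ atoms`).  THIS FILE:
**`five_le_card_of_generates`** — every finite family `S ⊂ ℤ^{64}` with `H ≤ P ⊔ Mk ⊔ Σ_{s ∈ S} ℤ[G]·s` has `|S| ≥ 5`, hence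
**`deficiency_five`**: `μ(ℤ/6 × ℤ/2) = 5` exactly (modulo the divisor classes and the two Weil orbits of the fourfolds `E × T`).
No named fact, no `sorry`; `decide`, `simp`, linear algebra over `ZMod 2`.  HC_CM is not proved anywhere in this cell.

WHY NOT PARITIES.  The block parities (the invariant of the `Dic₃`/`ℤ/12` files) see only `dim_{𝔽₂} (H/(P+Mk) ⊗ 𝔽₂)_G = 4` here, and every
character of `G` occurs in `(H/(P+Mk)) ⊗ ℚ` with multiplicity `4` (oracle `twist62.py` / `NEXT-ROWS.md`), so no semisimple invariant gives `5`.
THE `𝔽₄`-INVARIANT.  Let `W = 𝔽₂²` with the generator `(1,0)` of `G` acting by `T = (0 1; 1 1)` (`T² = T + 1`, `T³ = 1`: `W = 𝔽₄`, `(1,0) ↦ ω`)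
and `c = (0,1)` acting trivially.  For a label `y` of a threefold or sixfold block let `ε(y) ∈ ℤ/3` be the exponent of `(1,0)` of any group
element over `y` (`expo`) and `cvec ε = T^ε (1,0)`.  `twist : ℤ^{64} → W⁵`, `(twist v)_i = Σ_{y ∈ block i} v(y)·cvec (ε y)` over the five blocks
`T₀, T₁, B₀, B₁, B₂` (`twBlock`), is `ℤ`-linear, kills every conjugate pair (`c` acts trivially, `2 = 0`) and every translate of the Weil
orbits (`1 + T + T² = 0`), and is EQUIVARIANT: `twist (transl g v) = T^{g₁} · twist v` (`twist_transl`, checked on the `64` unit vectors by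
`decide` and extended by linearity).  It maps `H` ONTO `W⁵ = 𝔽₂^{10}` (`twist_unitWitness`: ten sums of one or two atom translates).  If
`H ≤ P ⊔ Mk ⊔ Σ_{s∈S} ℤ[G]·s` then `twist(H)` lies in the `𝔽₂`-span of the `2|S|` vectors `twist s`, `T·twist s` (`T² = 1 + T`), so
`10 ≤ 2|S|`.  (Equivalently: `(H/(P+Mk)) ⊗ 𝔽₂` modulo `Φ₃((1,0))` is a `5`-dimensional `𝔽₄`-space — oracle index `2^{10}`.)
-/

namespace Summit.HodgeConjecture.CorCM.Census.DodecicC6C2Species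

open Finset

/-! ## The twisted invariant `twist : ℤ^{64} → 𝔽₂^{10} = (𝔽₂²)⁵` -/

/-- The three non-zero vectors `T^ε (1,0)` of `W = 𝔽₂²`, `ε = 0, 1, 2` (`T = (0 1; 1 1)`). [folklore] -/
def cvec : Fin 3 → Fin 2 → ZMod 2 := ![![1, 0], ![0, 1], ![1, 1]]

/-- Exponent class `ε(y) ∈ ℤ/3` of the generator `(1,0)` over a threefold/sixfold label (`0` on the curve labels, unused). [folklore] -/
def expo : Pt → Fin 3
  | Sum.inl _ => 0
  | Sum.inr (Sum.inl (j, u)) => if j = 0 then ⟨u.val % 3, Nat.mod_lt _ (by omega)⟩ else ⟨(2 * u.val) % 3, Nat.mod_lt _ (by omega)⟩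
  | Sum.inr (Sum.inr (_, g)) => ⟨g.1.val % 3, Nat.mod_lt _ (by omega)⟩

/-- The five blocks carrying the invariant: `T₀, T₁, B₀, B₁, B₂` (slots `i = 0, …, 4`). [folklore] -/
def twBlock (i : Fin 5) : Pt → Bool
  | Sum.inl _ => false
  | Sum.inr (Sum.inl (j, _)) => decide ((i = 0 ∧ j = 0) ∨ (i = 1 ∧ j = 1))
  | Sum.inr (Sum.inr (j, _)) => decide ((i = 2 ∧ j = 0) ∨ (i = 3 ∧ j = 1) ∨ (i = 4 ∧ j = 2))

/-- Slot `k ↦ (block k / 2, coordinate k % 2)` of `𝔽₂^{10} = (𝔽₂²)⁵`. [folklore] -/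
def slot (k : Fin 10) : Fin 5 × Fin 2 := (⟨k.val / 2, by omega⟩, ⟨k.val % 2, Nat.mod_lt _ (by omega)⟩)

/-- Coefficient of the label `y` in coordinate `k` of the twist: `[y ∈ block(k)] · (T^{ε(y)}(1,0))_{k mod 2}`. [folklore] -/
def twCoef (y : Pt) (k : Fin 10) : ZMod 2 := if twBlock (slot k).1 y then cvec (expo y) (slot k).2 else 0

/-- **The `𝔽₄`-twisted invariant** `twist : ℤ^{64} → 𝔽₂^{10}`, `(twist v)_{2i+r} = Σ_{y ∈ block i} v(y) · (T^{ε(y)}(1,0))_r`. [folklore] -/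
def twist : (Pt → ℤ) →ₗ[ℤ] (Fin 10 → ZMod 2) where
  toFun v := fun k => ∑ y : Pt, (v y : ZMod 2) * twCoef y k
  map_add' v w := by
    funext k
    simp only [Pi.add_apply, Int.cast_add, add_mul, Finset.sum_add_distrib]
  map_smul' c v := by
    funext k
    simp only [Pi.smul_apply, smul_eq_mul, Int.cast_mul, RingHom.id_apply, zsmul_eq_mul, Finset.mul_sum, mul_assoc]

/-- `T` on each `𝔽₂²`-block of `𝔽₂^{10}` (`T(w₀, w₁) = (w₁, w₀ + w₁)`), an additive map. [folklore] -/
def Tall : (Fin 10 → ZMod 2) →+ (Fin 10 → ZMod 2) where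
  toFun x := ![x 1, x 0 + x 1, x 3, x 2 + x 3, x 5, x 4 + x 5, x 7, x 6 + x 7, x 9, x 8 + x 9]
  map_zero' := by decide
  map_add' x x' := by
    funext k
    fin_cases k <;> simp [add_add_add_comm]

/-- `T² = 1 + T`. [folklore] -/
theorem Tall_Tall (x : Fin 10 → ZMod 2) : Tall (Tall x) = x + Tall x := by
  funext k
  fin_cases k <;> simp [Tall]

/-- The action of `g = (a, b)` on `𝔽₂^{10}`: `T^{a mod 3}` (`c = (0,1)` acts trivially). [folklore] -/
def Mg (g : G) : (Fin 10 → ZMod 2) →+ (Fin 10 → ZMod 2) :=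
  if g.1.val % 3 = 0 then AddMonoidHom.id _ else if g.1.val % 3 = 1 then Tall else Tall.comp Tall

/-- `Mg g x` lies in any `𝔽₂`-subspace containing `x` and `T x`. [folklore] -/
theorem Mg_mem (g : G) {p : Submodule (ZMod 2) (Fin 10 → ZMod 2)} {x : Fin 10 → ZMod 2} (h1 : x ∈ p) (h2 : Tall x ∈ p) :
    Mg g x ∈ p := by
  unfold Mg
  split_ifs
  · exact h1
  · exact h2
  · rw [AddMonoidHom.comp_apply, Tall_Tall]; exact p.add_mem h1 h2

/-- Translation as a `ℤ`-linear map. [folklore] -/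
def translLin (g : G) : (Pt → ℤ) →ₗ[ℤ] (Pt → ℤ) where
  toFun := transl g
  map_add' v w := by funext y; rfl
  map_smul' c v := by funext y; rfl

/-- The twist of a unit vector is its coefficient row. [folklore] -/
theorem twist_unitVec (y : Pt) : twist (unitVec y) = fun k => twCoef y k := by
  funext k
  show ∑ y' : Pt, ((unitVec y y' : ℤ) : ZMod 2) * twCoef y' k = twCoef y k
  simp only [unitVec, Int.cast_ite, Int.cast_one, Int.cast_zero, ite_mul, one_mul, zero_mul, Finset.sum_ite_eq',
    Finset.mem_univ, if_true]

/-- Translates of unit vectors are unit vectors. [folklore] -/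
theorem transl_unitVec (g : G) (y : Pt) : transl g (unitVec y) = unitVec (act g y) := by
  funext y'
  show (if act (-g) y' = y then (1 : ℤ) else 0) = if y' = act g y then 1 else 0
  have key : act (-g) y' = y ↔ y' = act g y := by
    constructor
    · intro h; rw [← h, ← sanity.2.1, add_neg_cancel, sanity.2.2]
    · intro h; rw [h, ← sanity.2.1, neg_add_cancel, sanity.2.2]
  simp only [key]

set_option maxRecDepth 20000 in
/-- Equivariance on the coefficient rows (certificate): the row of `g·y` is `T^{g₁}` applied to the row of `y`. [folklore] -/
theorem twCoef_act : ∀ g : G, ∀ y : Pt, (fun k => twCoef (act g y) k) = Mg g (fun k => twCoef y k) := by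
  decide +kernel

/-- Equivariance on unit vectors. [folklore] -/
theorem twist_transl_unit (g : G) (y : Pt) : twist (transl g (unitVec y)) = Mg g (twist (unitVec y)) := by
  rw [transl_unitVec, twist_unitVec, twist_unitVec]
  exact twCoef_act g y

/-- **Equivariance.**  `twist (g · v) = T^{g₁} · twist v`. [folklore] -/
theorem twist_transl (g : G) (v : Pt → ℤ) : twist (transl g v) = Mg g (twist v) := by
  have hv : v = ∑ y : Pt, v y • unitVec y := by
    funext y'
    simp only [Finset.sum_apply, Pi.smul_apply, unitVec, smul_eq_mul, mul_ite, mul_one, mul_zero, Finset.sum_ite_eq,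
      Finset.mem_univ, if_true]
  have h1 : transl g v = translLin g v := rfl
  rw [h1, hv, map_sum, map_sum, map_sum, map_sum]
  refine Finset.sum_congr rfl fun y _ => ?_
  rw [map_smul, map_smul, map_smul, map_zsmul]
  exact congrArg (fun x => v y • x) (twist_transl_unit g y)

set_option maxRecDepth 20000 in
/-- The twist kills every conjugate pair (`c` acts trivially, `2 = 0`). [folklore] -/
theorem twist_pairVec : ∀ x : Pt, twist (pairVec x) = 0 := by
  decide +kernel

set_option maxRecDepth 20000 in
/-- The twist kills every translate of the two Weil orbits (`1 + T + T² = 0`). [folklore] -/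
theorem twist_mk : ∀ g : G, ∀ k : Fin 2, twist (transl g (mkVec k)) = 0 := by
  decide +kernel

/-- Ten Hodge vectors (sums of one or two atom translates) whose twists are the unit vectors of `𝔽₂^{10}`. [folklore] -/
def twWitness : Fin 10 → (Pt → ℤ) := ![transl (1, 0) (atomVec 4),
  transl (2, 0) (atomVec 4),
  transl (1, 0) (atomVec 3),
  transl (2, 0) (atomVec 3),
  transl (1, 0) (atomVec 0) + transl (1, 0) (atomVec 1),
  transl (2, 0) (atomVec 0) + transl (2, 0) (atomVec 1),
  transl (0, 0) (atomVec 1) + transl (1, 0) (atomVec 2),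
  transl (1, 0) (atomVec 1) + transl (2, 0) (atomVec 2),
  transl (2, 0) (atomVec 1),
  transl (0, 0) (atomVec 1)]

set_option maxRecDepth 20000 in
/-- The twist maps `H` ONTO `𝔽₂^{10}`. [folklore] -/
theorem twist_twWitness : ∀ k : Fin 10, twist (twWitness k) = Pi.single k 1 := by
  decide +kernel

/-- The witnesses are Hodge vectors (they lie in `A ≤ H`). [folklore] -/
theorem twWitness_mem (k : Fin 10) : twWitness k ∈ hodgeLattice := by
  refine atoms_le ?_
  fin_cases k <;> simp only [twWitness] <;>
    repeat (first | exact transl_atomVec_mem _ _ | refine Submodule.add_mem _ ?_ ?_)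

/-- **MINIMALITY (`μ(ℤ/6 × ℤ/2) ≥ 5`).**  If the Hodge lattice is generated, together with the divisor classes and the two Weil orbits,
by the translates of a finite family `S` of integer vectors, then `|S| ≥ 5`: `twist` maps `P ⊔ Mk ⊔ Σ_{s∈S} ℤ[G]·s` into the `𝔽₂`-span of
the `2|S|` vectors `twist s`, `T·twist s` (`twist_transl`, `T² = 1 + T`), and maps `H` onto `𝔽₂^{10}`. [folklore] -/
theorem five_le_card_of_generates (S : Finset (Pt → ℤ))
    (hS : hodgeLattice ≤ pairs ⊔ markman ⊔ Submodule.span ℤ {v | ∃ g : G, ∃ t ∈ S, v = transl g t}) : 5 ≤ S.card := by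
  classical
  let T : Finset (Fin 10 → ZMod 2) := S.image twist ∪ S.image (fun t => Tall (twist t))
  let W : Submodule ℤ (Fin 10 → ZMod 2) := (Submodule.span (ZMod 2) (T : Set (Fin 10 → ZMod 2))).restrictScalars ℤ
  have hle : pairs ⊔ markman ⊔ Submodule.span ℤ {v | ∃ g : G, ∃ t ∈ S, v = transl g t} ≤ W.comap twist := by
    refine sup_le (sup_le (Submodule.span_le.mpr ?_) (Submodule.span_le.mpr ?_)) (Submodule.span_le.mpr ?_)
    · rintro _ ⟨x, rfl⟩
      simp [W, twist_pairVec x]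
    · rintro _ ⟨p, rfl⟩
      simp [W, twist_mk p.1 p.2]
    · rintro _ ⟨g, t, ht, rfl⟩
      have h1 : twist t ∈ Submodule.span (ZMod 2) (T : Set (Fin 10 → ZMod 2)) :=
        Submodule.subset_span (by simp [T]; exact Or.inl ⟨t, ht, rfl⟩)
      have h2 : Tall (twist t) ∈ Submodule.span (ZMod 2) (T : Set (Fin 10 → ZMod 2)) :=
        Submodule.subset_span (by simp [T]; exact Or.inr ⟨t, ht, rfl⟩)
      simpa [W, twist_transl] using Mg_mem g h1 h2
  have hunit : ∀ k : Fin 10, (Pi.single k 1 : Fin 10 → ZMod 2) ∈ Submodule.span (ZMod 2) (T : Set (Fin 10 → ZMod 2)) := by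
    intro k
    have h := hle (hS (twWitness_mem k))
    simpa [W, twist_twWitness k] using h
  have htop : Submodule.span (ZMod 2) (T : Set (Fin 10 → ZMod 2)) = ⊤ := by
    refine Submodule.eq_top_iff'.mpr fun w => ?_
    rw [pi_eq_sum_univ' w]
    exact Submodule.sum_mem _ fun k _ => Submodule.smul_mem _ _ (hunit k)
  have h1 : Module.finrank (ZMod 2) (Submodule.span (ZMod 2) (T : Set (Fin 10 → ZMod 2))) ≤ T.card :=
    finrank_span_finset_le_card T
  rw [htop, finrank_top, Module.finrank_fin_fun] at h1
  have h2 : T.card ≤ S.card + S.card :=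
    (Finset.card_union_le _ _).trans (add_le_add Finset.card_image_le Finset.card_image_le)
  omega

/-- **`μ(ℤ/6 × ℤ/2) = 5`.**  `H = P ⊔ Mk ⊔ A` with `A` generated by five orbits (`lattice_theorem`), and no family of fewer than five
orbits of integer vectors generates `H` together with `P ⊔ Mk` (`five_le_card_of_generates`). [folklore] -/
theorem deficiency_five_c6c2 :
    hodgeLattice = pairs ⊔ markman ⊔ Submodule.span ℤ (Set.range fun p : G × Fin 5 => transl p.1 (atomVec p.2)) ∧
    ∀ S : Finset (Pt → ℤ), hodgeLattice ≤ pairs ⊔ markman ⊔ Submodule.span ℤ {v | ∃ g : G, ∃ t ∈ S, v = transl g t} → 5 ≤ S.card :=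
  ⟨lattice_theorem, five_le_card_of_generates⟩

end Summit.HodgeConjecture.CorCM.Census.DodecicC6C2Species
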